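import Summits.QuantumAdvantage.QuantumAdvantage.Theorems.CoSupportLawC
import Literature.Combinatorics.Extremal.SubsetSampling

set_option linter.dupNamespace false

/-!
# LAW I (co-support law), part D — LAW I′, the global-support law

Averaging LAW I-on-a-subcube (`loss_of_quadCoSupport_subcube`, part C) over all `s`-subsets of the coordinates:
* `pairsIn` (members of the tree's `InnerDegreeDial.offSupp` inside `T`), `sum_card_pairsIn` (double count via
  `Literature.Combinatorics.Extremal.card_filter_pair_mem_powersetCard_eq_choose`), `card_le_freeOf_add` (few support pairs inside `T` ⇒ many
  isolated coordinates of the block), `choose_mul_eq`;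
* `loss_of_fewPairs` (general `s`, `B`) and `loss_of_quadTotalSupport`: `QuadForm` registers with total ordered off-diagonal support
  `(Σ_g |offSupp (M g)|)·2m₁(2m₁−1) < (⌊m₁/2⌋+1)·n(n−1)` lose — a perfect strategy carries total quadratic support `≳ n²/(8m₁)`.
-/

open Finset
open Summit.QuantumAdvantage.AdviceFreeQNC0
open Summit.QuantumAdvantage.AdviceFreeQNC0.Coset21.CharTwoKill

namespace Summit.QuantumAdvantage.QuantumAdvantage.Theorems.CoSupportDial

/-! ### §5d LAW I′ — the global-support law (averaging LAW I-subcube over all `s`-subsets of the bits) -/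

section TotalSupport

variable {p : ℕ} [Fact p.Prime]

/-- the support pairs INSIDE a set `T` of coordinates: the members of the tree's ORDERED off-diagonal support `InnerDegreeDial.offSupp M`
(pairs `(i, j)`, `i ≠ j`, `M i j ≠ 0` — at most twice the edge count of the graph of `M`) with both ends in `T` -/
def pairsIn {n : ℕ} (M : Fin n → Fin n → ZMod p) (T : Finset (Fin n)) : Finset (Fin n × Fin n) :=
  (InnerDegreeDial.offSupp M).filter fun ij => ij.1 ∈ T ∧ ij.2 ∈ T

/-- DOUBLE COUNT: summed over all `s`-subsets `T` of the coordinates, the number of support pairs inside `T` is `|offSupp M| · C(n−2, s−2)`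
(each pair lies in exactly `C(n−2, s−2)` of them; `Literature.Combinatorics.Extremal.card_filter_pair_mem_powersetCard_eq_choose`). -/
theorem sum_card_pairsIn {n s : ℕ} (hs : 2 ≤ s) (M : Fin n → Fin n → ZMod p) :
    ∑ T ∈ (univ : Finset (Fin n)).powersetCard s, (pairsIn M T).card = (InnerDegreeDial.offSupp M).card * (n - 2).choose (s - 2) := by
  classical
  calc ∑ T ∈ (univ : Finset (Fin n)).powersetCard s, (pairsIn M T).card
      = ∑ T ∈ (univ : Finset (Fin n)).powersetCard s, ∑ ij ∈ InnerDegreeDial.offSupp M, (if ij.1 ∈ T ∧ ij.2 ∈ T then 1 else 0) := by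
        refine sum_congr rfl fun T _ => ?_
        rw [pairsIn, card_filter]
    _ = ∑ ij ∈ InnerDegreeDial.offSupp M, ∑ T ∈ (univ : Finset (Fin n)).powersetCard s, (if ij.1 ∈ T ∧ ij.2 ∈ T then 1 else 0) := sum_comm
    _ = ∑ ij ∈ InnerDegreeDial.offSupp M, (((univ : Finset (Fin n)).powersetCard s).filter fun T => ij.1 ∈ T ∧ ij.2 ∈ T).card := by
        refine sum_congr rfl fun ij _ => ?_
        rw [card_filter]
    _ = ∑ ij ∈ InnerDegreeDial.offSupp M, (n - 2).choose (s - 2) := by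
        refine sum_congr rfl fun ij hij => ?_
        have hne : ij.1 ≠ ij.2 := ((mem_filter.mp hij).2).1
        rw [Literature.Combinatorics.Extremal.card_filter_pair_mem_powersetCard_eq_choose univ (mem_univ _) (mem_univ _) hne hs,
          card_univ, Fintype.card_fin]
    _ = (InnerDegreeDial.offSupp M).card * (n - 2).choose (s - 2) := by rw [sum_const, smul_eq_mul]

/-- FEW PAIRS INSIDE ⇒ MANY ISOLATED: on the block of `M` spanned by an enumeration `e` of `T`, every non-isolated coordinate is an endpoint of
a support pair inside `T`, so `s ≤ |freeOf block| + 2·|pairsIn M T|`. -/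
theorem card_le_freeOf_add {n s : ℕ} (M : Fin n → Fin n → ZMod p) (T : Finset (Fin n)) (e : Fin s ↪ Fin n) (he : ∀ j, e j ∈ T) :
    s ≤ (freeOf (fun j j' => M (e j) (e j'))).card + 2 * (pairsIn M T).card := by
  classical
  set B : Fin s → Fin s → ZMod p := fun j j' => M (e j) (e j') with hB
  have hsplit : (freeOf B).card + (univ.filter fun j : Fin s => ¬ j ∈ freeOf B).card = s := by
    have h := card_filter_add_card_filter_not (s := (univ : Finset (Fin s))) (fun j => j ∈ freeOf B)
    rw [filter_mem_eq_inter, univ_inter, card_univ, Fintype.card_fin] at h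
    exact h
  have hsub : (univ.filter fun j : Fin s => ¬ j ∈ freeOf B).map e ⊆ (pairsIn M T).image Prod.fst ∪ (pairsIn M T).image Prod.snd := by
    intro i hi
    rw [mem_map] at hi
    obtain ⟨j, hj, rfl⟩ := hi
    have hj' : ¬ ∀ j', j' ≠ j → B j j' = 0 ∧ B j' j = 0 := by
      intro hall
      exact (mem_filter.mp hj).2 (mem_filter.mpr ⟨mem_univ _, hall⟩)
    push Not at hj'
    obtain ⟨j', hne, hjj'⟩ := hj'
    have hee : e j ≠ e j' := fun h => hne (e.injective h).symm
    rw [mem_union, mem_image, mem_image]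
    by_cases h1 : B j j' = 0
    · right
      refine ⟨(e j', e j), ?_, rfl⟩
      unfold pairsIn InnerDegreeDial.offSupp
      simp only [mem_filter, mem_univ, true_and]
      exact ⟨⟨hee.symm, hjj' h1⟩, he j', he j⟩
    · left
      refine ⟨(e j, e j'), ?_, rfl⟩
      unfold pairsIn InnerDegreeDial.offSupp
      simp only [mem_filter, mem_univ, true_and]
      exact ⟨⟨hee, h1⟩, he j, he j'⟩
  have hle : (univ.filter fun j : Fin s => ¬ j ∈ freeOf B).card ≤ 2 * (pairsIn M T).card := by
    calc (univ.filter fun j : Fin s => ¬ j ∈ freeOf B).card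
        = ((univ.filter fun j : Fin s => ¬ j ∈ freeOf B).map e).card := (card_map _).symm
      _ ≤ ((pairsIn M T).image Prod.fst ∪ (pairsIn M T).image Prod.snd).card := card_le_card hsub
      _ ≤ ((pairsIn M T).image Prod.fst).card + ((pairsIn M T).image Prod.snd).card := card_union_le _ _
      _ ≤ (pairsIn M T).card + (pairsIn M T).card := Nat.add_le_add card_image_le card_image_le
      _ = 2 * (pairsIn M T).card := by ring
  omega

/-- `C(n, s)·s(s−1) = n(n−1)·C(n−2, s−2)` for `2 ≤ s` -/
theorem choose_mul_eq {n s : ℕ} (hs : 2 ≤ s) (hsn : s ≤ n) :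
    n.choose s * (s * (s - 1)) = n * (n - 1) * (n - 2).choose (s - 2) := by
  obtain ⟨s', rfl⟩ : ∃ s', s = s' + 2 := ⟨s - 2, by omega⟩
  obtain ⟨n', rfl⟩ : ∃ n', n = n' + 2 := ⟨n - 2, by omega⟩
  simp only [Nat.add_sub_cancel]
  have h1 := Nat.add_one_mul_choose_eq (n' + 1) (s' + 1)
  have h2 := Nat.add_one_mul_choose_eq n' s'
  have : (n' + 2) * ((n' + 1) * n'.choose s') = (n' + 2).choose (s' + 2) * (s' + 2) * (s' + 1) := by
    rw [h2, ← mul_assoc, h1]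
  calc (n' + 2).choose (s' + 2) * ((s' + 2) * (s' + 2 - 1)) = (n' + 2).choose (s' + 2) * (s' + 2) * (s' + 1) := by
        rw [show s' + 2 - 1 = s' + 1 by omega]; ring
    _ = (n' + 2) * (n' + 2 - 1) * n'.choose s' := by rw [← this, show n' + 2 - 1 = n' + 1 by omega]; ring

/-- **LAW I′ (global-support law), general form.**  `QuadForm` registers; if for some `s` and `B` with `m₁ + 2B ≤ s` the TOTAL ordered
off-diagonal support satisfies `(Σ_g |offSupp (M g)|)·C(n−2, s−2) < (B+1)·C(n, s)` — i.e. the average over `s`-sets `T` of the number of support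
pairs inside `T` is `< B + 1` — then some `s`-set carries `≤ B` pairs of every register at once, every block leaves `≥ s − 2B ≥ m₁` coordinates
isolated, and LAW I on that subcube (`loss_of_quadCoSupport_subcube`) gives a loss. -/
theorem loss_of_fewPairs (hp5 : 5 ≤ p) {n k m₁ s B : ℕ} (hs : 2 ≤ s) (hmB : m₁ + 2 * B ≤ s)
    (hcount : (n + 1) * (p ^ (k + 1) * p * 2) * (2 * p - 1) ^ m₁ < (2 * p) ^ m₁) (c : ℕ)
    (y : Fin (n + 1) → (Fin n → Bool) → Bool)
    (lam : Fin (n + 1) → Fin k → Fin n → ZMod p) (M : Fin (n + 1) → Fin n → Fin n → ZMod p)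
    (b : Fin (n + 1) → Fin n → ZMod p) (F : Fin (n + 1) → (Fin k → ZMod p) → ZMod p → Bool)
    (hy : ∀ g u, y g u = F g (fun j => ∑ i, if u i = true then lam g j i else 0) (InnerDegreeDial.quadVal (M g) (b g) u))
    (hsupp : (∑ g, (InnerDegreeDial.offSupp (M g)).card) * (n - 2).choose (s - 2) < (B + 1) * n.choose s) :
    ∃ u, ringWinU c y u = false := by
  classical
  -- an `s`-set with at most `B` support pairs of every register inside it (strict pigeonhole on the double count)
  have hsum : ∑ T ∈ (univ : Finset (Fin n)).powersetCard s, (∑ g, (pairsIn (M g) T).card)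
      < ∑ T ∈ (univ : Finset (Fin n)).powersetCard s, (B + 1) := by
    rw [sum_comm, sum_const, smul_eq_mul, card_powersetCard, card_univ, Fintype.card_fin]
    simp_rw [sum_card_pairsIn hs]
    rw [← sum_mul, mul_comm (n.choose s)]
    exact hsupp
  obtain ⟨T, hT, hTB⟩ := exists_lt_of_sum_lt hsum
  have hTcard : T.card = s := (mem_powersetCard.mp hT).2
  -- enumerate `T` and apply LAW I on the subcube it spans (frozen bits all `false`; any freezing works)
  let e : Fin s ↪ Fin n := (T.orderEmbOfFin hTcard).toEmbedding
  have he : ∀ j, e j ∈ T := fun j => T.orderEmbOfFin_mem hTcard j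
  have hfree : ∀ g, m₁ ≤ (freeOf (fun j j' => M g (e j) (e j'))).card := by
    intro g
    have h1 := card_le_freeOf_add (M g) T e he
    have h2 : (pairsIn (M g) T).card ≤ B :=
      le_trans (single_le_sum (f := fun g' => (pairsIn (M g') T).card) (fun _ _ => Nat.zero_le _) (mem_univ g))
        (Nat.lt_succ_iff.mp hTB)
    omega
  obtain ⟨v, hv⟩ := loss_of_quadCoSupport_subcube hp5 (show m₁ ≤ s by omega) hcount c y lam M b F hy (fun _ => false) e hfree
  exact ⟨_, hv⟩

/-- **LAW I′ (global-support law).**  With the LAW-I threshold `m₁` (`1 ≤ m₁`, `2m₁ ≤ n`, count as in `loss_of_quadCoSupport`): if the total ordered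
off-diagonal support of the quadratic parts satisfies `(Σ_g |offSupp (M g)|)·2m₁(2m₁−1) < (⌊m₁/2⌋+1)·n(n−1)`, the strategy loses.  Contrapositive
(the residual portrait): a perfect `QuadForm` strategy carries total quadratic support `≥ n(n−1)(⌊m₁/2⌋+1)/(2m₁(2m₁−1)) ≈ n²/(8m₁) = n²/polylog`. -/
theorem loss_of_quadTotalSupport (hp5 : 5 ≤ p) {n k m₁ : ℕ} (hm₁ : 1 ≤ m₁) (hmn : 2 * m₁ ≤ n)
    (hcount : (n + 1) * (p ^ (k + 1) * p * 2) * (2 * p - 1) ^ m₁ < (2 * p) ^ m₁) (c : ℕ)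
    (y : Fin (n + 1) → (Fin n → Bool) → Bool)
    (lam : Fin (n + 1) → Fin k → Fin n → ZMod p) (M : Fin (n + 1) → Fin n → Fin n → ZMod p)
    (b : Fin (n + 1) → Fin n → ZMod p) (F : Fin (n + 1) → (Fin k → ZMod p) → ZMod p → Bool)
    (hy : ∀ g u, y g u = F g (fun j => ∑ i, if u i = true then lam g j i else 0) (InnerDegreeDial.quadVal (M g) (b g) u))
    (hsupp : (∑ g, (InnerDegreeDial.offSupp (M g)).card) * (2 * m₁ * (2 * m₁ - 1)) < (m₁ / 2 + 1) * (n * (n - 1))) :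
    ∃ u, ringWinU c y u = false := by
  have hs : 2 ≤ 2 * m₁ := by omega
  refine loss_of_fewPairs hp5 hs (B := m₁ / 2) (by omega) hcount c y lam M b F hy ?_
  -- convert the `n(n−1)` form into the binomial form using `C(n,s)·s(s−1) = n(n−1)·C(n−2,s−2)`
  have hid := choose_mul_eq hs hmn
  have hpos : 0 < 2 * m₁ * (2 * m₁ - 1) := by
    have : 1 ≤ 2 * m₁ - 1 := by omega
    positivity
  refine Nat.lt_of_mul_lt_mul_right (a := 2 * m₁ * (2 * m₁ - 1)) ?_
  calc (∑ g, (InnerDegreeDial.offSupp (M g)).card) * (n - 2).choose (2 * m₁ - 2) * (2 * m₁ * (2 * m₁ - 1))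
      = (∑ g, (InnerDegreeDial.offSupp (M g)).card) * (2 * m₁ * (2 * m₁ - 1)) * (n - 2).choose (2 * m₁ - 2) := by ring
    _ < (m₁ / 2 + 1) * (n * (n - 1)) * (n - 2).choose (2 * m₁ - 2) :=
        Nat.mul_lt_mul_of_pos_right hsupp (Nat.choose_pos (by omega))
    _ = (m₁ / 2 + 1) * n.choose (2 * m₁) * (2 * m₁ * (2 * m₁ - 1)) := by
        rw [mul_assoc (m₁ / 2 + 1) (n.choose (2 * m₁)), hid]; ring

end TotalSupport

end Summit.QuantumAdvantage.QuantumAdvantage.Theorems.CoSupportDial
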